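import Summits.BirchSwinnertonDyer.BirchSwinnertonDyer.Theorems.Rank2Observatory2DescKillSig12RDefs
import Summits.BirchSwinnertonDyer.BirchSwinnertonDyer.Theorems.Rank2Observatory2DescKillSig12
import HarnessLib

/-!
# KERNEL-2DESC — TIER-2r signature kill `sig12rCheck`, part 2 of 3: soundness tools at the RAMIFIED quadratic place
# (rank-2 observatory, cert-1 gen 55; overview in `Rank2Observatory2DescKillSig12RDefs`)

HONEST FRAMING: per-curve certified theorems and census instruments; no claim on BSD in rank ≥ 2.
PARTITION: none — rank ≥ 2 data (N3); no r ≤ 1 cell claimed.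

Pairs `C + B·π'` with `π'² = dl = q·δ`, `q ∤ δ`.  The square of a `q`-primitive pair is `q^e·S` (`e ∈ {0, 1}`) with `S`
`C`-led and leading unit `≡ δ^e·ω²` (`sq_decompR`); multiplying by a primitive `U` keeps the lead side and multiplies the
leading units (`usq_decompR`); hence the PAIR CORE LEMMA `coreRam`: `q^N ∣ q^s·U·X² − q^j·W` (componentwise, `U`, `W`
primitive, `j < N`) forces the same lead side and `lead(W) ≡ lead(U)·δ^{(s+j) mod 2}·ω²` (mod `q`).  Then
`ramMis_sound`, the disc-walk soundness `walkR_sound` and the scaled kill `kill_scaledR` (walk at offset `K = 2τ`) —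
verbatim the tier-2u architecture (`quadMis_sound` / `walk2_sound` / `kill_scaled`) with the ramified reading.
Integers only. [cite: Cassels1991LecturesEllipticCurves, §15] [cite: CremonaAlgorithms1997, §3.6]
-/

-- single-conjunct summit: `Summit.BirchSwinnertonDyer.BirchSwinnertonDyer.…` repeats the name by design
set_option linter.dupNamespace false

namespace Summit.BirchSwinnertonDyer.BirchSwinnertonDyer.Rank2Observatory.TwoDescKill

/-! ### Soundness — tools at the ramified place -/

/-- **Square of a primitive pair.** For `X' = (C, B)` `q`-primitive: `X'² = q^e·S` with `e ∈ {0,1}`, `q ∤ S.1` and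
`S.1 ≡ δ^e·ω²` for a unit `ω` (`e = 0`, `ω = C` when `q ∤ C`; `e = 1`, `ω = B` when `q ∣ C`). [folklore] -/
theorem sq_decompR {q : ℕ} (hq : q.Prime) {dl dlt : ℤ} (hdl : dl = (q : ℤ) * dlt) (hdlt : ¬ (q : ℤ) ∣ dlt)
    {C B : ℤ} (hprim : ¬ ((q : ℤ) ∣ C ∧ (q : ℤ) ∣ B)) :
    ∃ (e : ℕ) (S : ℤ × ℤ) (ω : ℤ), e ≤ 1 ∧ ¬ (q : ℤ) ∣ ω ∧
      (pmul dl (C, B) (C, B)).1 = (q : ℤ) ^ e * S.1 ∧ (pmul dl (C, B) (C, B)).2 = (q : ℤ) ^ e * S.2 ∧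
      ¬ (q : ℤ) ∣ S.1 ∧ (q : ℤ) ∣ dlt ^ e * ω ^ 2 - S.1 := by
  have hpZ : Prime (q : ℤ) := Nat.prime_iff_prime_int.mp hq
  subst hdl
  by_cases hC : (q : ℤ) ∣ C
  · have hB : ¬ (q : ℤ) ∣ B := fun hB => hprim ⟨hC, hB⟩
    obtain ⟨C₁, hC₁⟩ := hC
    refine ⟨1, ((q : ℤ) * C₁ * C₁ + dlt * B * B, C₁ * B + B * C₁), B, le_rfl, hB, ?_, ?_, ?_, ?_⟩
    · simp only [pmul, hC₁]; ring
    · simp only [pmul, hC₁]; ring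
    · intro h
      have h2 : (q : ℤ) ∣ dlt * B * B := by
        simpa using dvd_sub h (⟨C₁ * C₁, by ring⟩ : (q : ℤ) ∣ (q : ℤ) * C₁ * C₁)
      rcases hpZ.dvd_mul.mp h2 with h3 | h3
      · rcases hpZ.dvd_mul.mp h3 with h4 | h4
        · exact hdlt h4
        · exact hB h4
      · exact hB h3
    · exact ⟨-(C₁ * C₁), by ring⟩
  · refine ⟨0, (C * C + (q : ℤ) * dlt * B * B, C * B + B * C), C, Nat.zero_le _, hC, ?_, ?_, ?_, ?_⟩
    · simp only [pmul]; ring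
    · simp only [pmul]; ring
    · intro h
      have h2 : (q : ℤ) ∣ C * C := by
        simpa using dvd_sub h (⟨dlt * B * B, by ring⟩ : (q : ℤ) ∣ (q : ℤ) * dlt * B * B)
      exact hC ((hpZ.dvd_mul.mp h2).elim id id)
    · exact ⟨-(dlt * B * B), by ring⟩

/-- **`U·X²` at the ramified place.** For `U` primitive and `X ≠ 0`: `U·X² = q^{2t+e}·A` with `A` primitive, the
same lead side as `U`, and `lead(A) ≡ lead(U)·δ^e·ω²` (mod `q`) for a unit `ω`; also `q^t ∣ X`. [folklore] -/
theorem usq_decompR {q : ℕ} (hq : q.Prime) {dl dlt : ℤ} (hdl : dl = (q : ℤ) * dlt) (hdlt : ¬ (q : ℤ) ∣ dlt)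
    {U X : ℤ × ℤ} (hU : ¬ ((q : ℤ) ∣ U.1 ∧ (q : ℤ) ∣ U.2)) (hX : ¬ (X.1 = 0 ∧ X.2 = 0)) :
    ∃ (t e : ℕ) (A : ℤ × ℤ) (ω : ℤ), e ≤ 1 ∧ ¬ (q : ℤ) ∣ ω ∧
      (pmul dl U (pmul dl X X)).1 = (q : ℤ) ^ (2 * t + e) * A.1 ∧
      (pmul dl U (pmul dl X X)).2 = (q : ℤ) ^ (2 * t + e) * A.2 ∧
      ¬ ((q : ℤ) ∣ A.1 ∧ (q : ℤ) ∣ A.2) ∧ ramE q A = ramE q U ∧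
      (q : ℤ) ∣ ramU q U * dlt ^ e * ω ^ 2 - ramU q A ∧
      ((q : ℤ) ^ t ∣ X.1 ∧ (q : ℤ) ^ t ∣ X.2) := by
  have hpZ : Prime (q : ℤ) := Nat.prime_iff_prime_int.mp hq
  obtain ⟨t, C, B, hC, hB, hprim⟩ := exists_pow_prim hq hX
  obtain ⟨e, S, ω, he, hω, hS1, hS2, hSu, hSc⟩ := sq_decompR hq hdl hdlt hprim
  have h2t : (q : ℤ) ^ (2 * t + e) = (q : ℤ) ^ t * (q : ℤ) ^ t * (q : ℤ) ^ e := by rw [two_mul, pow_add, pow_add]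
  have hXX1 : (pmul dl X X).1 = (q : ℤ) ^ t * (q : ℤ) ^ t * ((q : ℤ) ^ e * S.1) := by
    rw [← hS1]; simp only [pmul, hC, hB]; ring
  have hXX2 : (pmul dl X X).2 = (q : ℤ) ^ t * (q : ℤ) ^ t * ((q : ℤ) ^ e * S.2) := by
    rw [← hS2]; simp only [pmul, hC, hB]; ring
  -- `A = U·S`
  refine ⟨t, e, (U.1 * S.1 + dl * U.2 * S.2, U.1 * S.2 + U.2 * S.1), ω, he, hω, ?_, ?_, ?_, ?_, ?_, ⟨C, hC⟩, ⟨B, hB⟩⟩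
  · rw [show (pmul dl U (pmul dl X X)).1 = U.1 * (pmul dl X X).1 + dl * U.2 * (pmul dl X X).2 from rfl,
      hXX1, hXX2, h2t]; ring
  · rw [show (pmul dl U (pmul dl X X)).2 = U.1 * (pmul dl X X).2 + U.2 * (pmul dl X X).1 from rfl,
      hXX1, hXX2, h2t]; ring
  · -- primitive
    subst hdl
    by_cases hU1 : (q : ℤ) ∣ U.1
    · have hU2 : ¬ (q : ℤ) ∣ U.2 := fun h => hU ⟨hU1, h⟩
      rintro ⟨-, h⟩
      have h2 : (q : ℤ) ∣ U.2 * S.1 := by simpa using dvd_sub h (dvd_mul_of_dvd_left hU1 S.2)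
      rcases hpZ.dvd_mul.mp h2 with h3 | h3
      · exact hU2 h3
      · exact hSu h3
    · rintro ⟨h, -⟩
      have h2 : (q : ℤ) ∣ U.1 * S.1 := by
        simpa using dvd_sub h (⟨dlt * U.2 * S.2, by ring⟩ : (q : ℤ) ∣ (q : ℤ) * dlt * U.2 * S.2)
      rcases hpZ.dvd_mul.mp h2 with h3 | h3
      · exact hU1 h3
      · exact hSu h3
  · -- same lead side
    subst hdl
    by_cases hU1 : (q : ℤ) ∣ U.1
    · have hA1 : (q : ℤ) ∣ U.1 * S.1 + (q : ℤ) * dlt * U.2 * S.2 :=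
        dvd_add (dvd_mul_of_dvd_left hU1 _) ⟨dlt * U.2 * S.2, by ring⟩
      rw [(ramE_of_dvd (V := (U.1 * S.1 + (q : ℤ) * dlt * U.2 * S.2, U.1 * S.2 + U.2 * S.1)) hA1).1,
        (ramE_of_dvd (V := U) hU1).1]
    · have hA1 : ¬ (q : ℤ) ∣ U.1 * S.1 + (q : ℤ) * dlt * U.2 * S.2 := by
        intro h
        have h2 : (q : ℤ) ∣ U.1 * S.1 := by
          simpa using dvd_sub h (⟨dlt * U.2 * S.2, by ring⟩ : (q : ℤ) ∣ (q : ℤ) * dlt * U.2 * S.2)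
        rcases hpZ.dvd_mul.mp h2 with h3 | h3
        · exact hU1 h3
        · exact hSu h3
      rw [(ramE_of_not_dvd (V := (U.1 * S.1 + (q : ℤ) * dlt * U.2 * S.2, U.1 * S.2 + U.2 * S.1)) hA1).1,
        (ramE_of_not_dvd (V := U) hU1).1]
  · -- leading units
    subst hdl
    by_cases hU1 : (q : ℤ) ∣ U.1
    · have hA1 : (q : ℤ) ∣ U.1 * S.1 + (q : ℤ) * dlt * U.2 * S.2 :=
        dvd_add (dvd_mul_of_dvd_left hU1 _) ⟨dlt * U.2 * S.2, by ring⟩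
      rw [(ramE_of_dvd (V := (U.1 * S.1 + (q : ℤ) * dlt * U.2 * S.2, U.1 * S.2 + U.2 * S.1)) hA1).2,
        (ramE_of_dvd (V := U) hU1).2]
      dsimp only
      have e1 : U.2 * dlt ^ e * ω ^ 2 - (U.1 * S.2 + U.2 * S.1) = U.2 * (dlt ^ e * ω ^ 2 - S.1) - U.1 * S.2 := by
        ring
      rw [e1]
      exact dvd_sub (dvd_mul_of_dvd_right hSc _) (dvd_mul_of_dvd_left hU1 _)
    · have hA1 : ¬ (q : ℤ) ∣ U.1 * S.1 + (q : ℤ) * dlt * U.2 * S.2 := by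
        intro h
        have h2 : (q : ℤ) ∣ U.1 * S.1 := by
          simpa using dvd_sub h (⟨dlt * U.2 * S.2, by ring⟩ : (q : ℤ) ∣ (q : ℤ) * dlt * U.2 * S.2)
        rcases hpZ.dvd_mul.mp h2 with h3 | h3
        · exact hU1 h3
        · exact hSu h3
      rw [(ramE_of_not_dvd (V := (U.1 * S.1 + (q : ℤ) * dlt * U.2 * S.2, U.1 * S.2 + U.2 * S.1)) hA1).2,
        (ramE_of_not_dvd (V := U) hU1).2]
      dsimp only
      have e1 : U.1 * dlt ^ e * ω ^ 2 - (U.1 * S.1 + (q : ℤ) * dlt * U.2 * S.2) =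
          U.1 * (dlt ^ e * ω ^ 2 - S.1) - (q : ℤ) * (dlt * U.2 * S.2) := by ring
      rw [e1]
      exact dvd_sub (dvd_mul_of_dvd_right hSc _) (dvd_mul_right _ _)

/-- **Core lemma at the ramified place.** `q^N ∣ q^s·U·X² − q^j·W` componentwise (pairs `C + Bπ'`, `π'² = q·δ`),
with `U`, `W` `q`-primitive and `j < N`, forces the same lead side of `U` and `W` and
`lead(W) ≡ lead(U)·δ^{(s+j) mod 2}·ω²` (mod `q`) for a unit `ω`: writing `U·X² = q^{2t+e}·A` (`usq_decompR`), both `A`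
and `W` are primitive, so the exponents `s + 2t + e` and `j` agree and `A ≡ W (mod q)`. No valuations. [folklore] -/
theorem coreRam {q : ℕ} (hq : q.Prime) {dl dlt : ℤ} (hdl : dl = (q : ℤ) * dlt) (hdlt : ¬ (q : ℤ) ∣ dlt)
    {U W X : ℤ × ℤ} (hU : ¬ ((q : ℤ) ∣ U.1 ∧ (q : ℤ) ∣ U.2)) (hW : ¬ ((q : ℤ) ∣ W.1 ∧ (q : ℤ) ∣ W.2))
    {s j N : ℕ} (hjN : j < N)
    (h1 : (q : ℤ) ^ N ∣ (q : ℤ) ^ s * (pmul dl U (pmul dl X X)).1 - (q : ℤ) ^ j * W.1)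
    (h2 : (q : ℤ) ^ N ∣ (q : ℤ) ^ s * (pmul dl U (pmul dl X X)).2 - (q : ℤ) ^ j * W.2) :
    ramE q U = ramE q W ∧
      ∃ ω : ℤ, ¬ (q : ℤ) ∣ ω ∧ (q : ℤ) ∣ ramU q U * dlt ^ ((s + j) % 2) * ω ^ 2 - ramU q W := by
  have hq0 : (q : ℤ) ≠ 0 := by exact_mod_cast hq.ne_zero
  have hjd : ∀ {x : ℤ}, (q : ℤ) ^ N ∣ -((q : ℤ) ^ j * x) → (q : ℤ) ∣ x := by
    intro x hx
    have : (q : ℤ) ^ (j + 1) ∣ (q : ℤ) ^ j * x := dvd_neg.mp (dvd_trans (pow_dvd_pow _ hjN) hx)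
    rw [pow_succ] at this
    exact (mul_dvd_mul_iff_left (pow_ne_zero j hq0)).mp this
  by_cases hX : X.1 = 0 ∧ X.2 = 0
  · exfalso
    have e1 : (pmul dl U (pmul dl X X)).1 = 0 := by simp only [pmul, hX.1, hX.2]; ring
    have e2 : (pmul dl U (pmul dl X X)).2 = 0 := by simp only [pmul, hX.1, hX.2]; ring
    rw [e1, mul_zero, zero_sub] at h1
    rw [e2, mul_zero, zero_sub] at h2
    exact hW ⟨hjd h1, hjd h2⟩
  obtain ⟨t, e, A, ω, he, hω, hA1, hA2, hAp, hAE, hAU, -⟩ := usq_decompR hq hdl hdlt hU hX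
  rw [hA1, ← mul_assoc, ← pow_add] at h1
  rw [hA2, ← mul_assoc, ← pow_add] at h2
  have heq : s + (2 * t + e) = j := by
    rcases Nat.lt_trichotomy (s + (2 * t + e)) j with hlt | heq | hgt
    · exact absurd ⟨dvd_of_lt_exp hq0 h1 hlt (by omega), dvd_of_lt_exp hq0 h2 hlt (by omega)⟩ hAp
    · exact heq
    · refine absurd ⟨dvd_of_lt_exp hq0 (y := A.1) ?_ hgt hjN,
        dvd_of_lt_exp hq0 (y := A.2) ?_ hgt hjN⟩ hW
      · rw [← neg_sub]; exact dvd_neg.mpr h1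
      · rw [← neg_sub]; exact dvd_neg.mpr h2
  rw [heq] at h1 h2
  have hc : ∀ {u w : ℤ}, (q : ℤ) ^ N ∣ (q : ℤ) ^ j * u - (q : ℤ) ^ j * w → (q : ℤ) ∣ u - w := by
    intro u w h
    have : (q : ℤ) ^ (j + 1) ∣ (q : ℤ) ^ j * (u - w) := by
      rw [mul_sub]; exact dvd_trans (pow_dvd_pow _ hjN) h
    rw [pow_succ] at this
    exact (mul_dvd_mul_iff_left (pow_ne_zero j hq0)).mp this
  have hc1 := hc h1
  have hc2 := hc h2
  have hpar : (s + j) % 2 = e := by omega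
  rw [hpar, ← hAE]
  -- `A ≡ W (mod q)`: same lead side, congruent leading coordinates
  by_cases hA1d : (q : ℤ) ∣ A.1
  · have hW1d : (q : ℤ) ∣ W.1 := by simpa using dvd_sub hA1d hc1
    rw [(ramE_of_dvd hA1d).1, (ramE_of_dvd hW1d).1, (ramE_of_dvd hW1d).2]
    rw [(ramE_of_dvd hA1d).2] at hAU
    exact ⟨rfl, ω, hω, by simpa using dvd_add hAU hc2⟩
  · have hW1d : ¬ (q : ℤ) ∣ W.1 := fun h => hA1d (by simpa using dvd_add hc1 h)
    rw [(ramE_of_not_dvd hA1d).1, (ramE_of_not_dvd hW1d).1, (ramE_of_not_dvd hW1d).2]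
    rw [(ramE_of_not_dvd hA1d).2] at hAU
    exact ⟨rfl, ω, hω, by simpa using dvd_add hAU hc1⟩

/-- **Decided ramified signature is sound**: for `y ≡ c (mod q^j)` on a disc where the quadratic centre is
decided, the pair relation `q^N ∣ q^{s₂}·U·X² − q^K·((y − E_C) − E_B π')` (`E_B = q^k B_u`, `K` even,
`K ≤ B`, `j + B < N`) forces the class signature to be the disc's (`ramMis` refutes it). [cite: CremonaAlgorithms1997, §3.6] -/
theorem ramMis_sound {q : ℕ} (hq : q.Prime) {dl dlt : ℤ} (hdl : dl = (q : ℤ) * dlt) (hdlt : ¬ (q : ℤ) ∣ dlt)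
    {U : ℤ × ℤ} (hU : ¬ ((q : ℤ) ∣ U.1 ∧ (q : ℤ) ∣ U.2)) {k : ℕ} {Bp Bu EC : ℤ} (hBu : ¬ (q : ℤ) ∣ Bu)
    (hBp : (q : ℤ) ∣ Bu - Bp) {s₂ : ℕ} {c : ℤ} {j : ℕ}
    (h : ramMis q k Bp EC s₂ (ramE q U) (eulerBit q (ramU q U)) (eulerBit q (ramU q U * dlt)) c j = true)
    {B N K : ℕ} (hK : K ≤ B) (hK2 : K % 2 = 0) (hj : j + B < N) {y : ℤ} (hy : (q : ℤ) ^ j ∣ y - c)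
    (hX : ∃ X : ℤ × ℤ,
      (q : ℤ) ^ N ∣ (q : ℤ) ^ s₂ * (pmul dl U (pmul dl X X)).1 - (q : ℤ) ^ K * (y - EC) ∧
      (q : ℤ) ^ N ∣ (q : ℤ) ^ s₂ * (pmul dl U (pmul dl X X)).2 - (q : ℤ) ^ K * (-((q : ℤ) ^ k * Bu))) :
    False := by
  obtain ⟨X, hX1, hX2⟩ := hX
  have hpZ : Prime (q : ℤ) := Nat.prime_iff_prime_int.mp hq
  have hq0 : (q : ℤ) ≠ 0 := by exact_mod_cast hq.ne_zero
  have cast_qj : ((q ^ j : ℕ) : ℤ) = (q : ℤ) ^ j := Nat.cast_pow q j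
  simp only [ramMis, Bool.and_eq_true] at h
  obtain ⟨⟨hdec, hunit⟩, hmis⟩ := h
  simp only [quadDecided, Bool.or_eq_true, Bool.not_eq_true', decide_eq_true_eq, decide_eq_false_iff_not,
    cast_qj] at hdec
  simp only [Bool.or_eq_true, Bool.not_eq_true', decide_eq_true_eq, decide_eq_false_iff_not, cast_qj] at hunit
  rw [cast_qj] at hmis
  have hsp := splitPow_spec q j (c - EC)
  set m₁ := (splitPow q j (c - EC)).1 with hm₁
  set w := (splitPow q j (c - EC)).2 with hw
  obtain ⟨t, ht⟩ := hy
  have hyE : y - EC = (q : ℤ) ^ j * t + (c - EC) := by linear_combination ht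
  -- `v(c − E_C) < j` when `c − E_C ≢ 0 (mod q^j)`
  have hm₁j : ¬ (c - EC) % (q : ℤ) ^ j = 0 → m₁ < j := by
    intro hδ
    by_contra hle
    push Not at hle
    exact hδ (Int.emod_eq_zero_of_dvd (hsp ▸ dvd_mul_of_dvd_left (pow_dvd_pow _ hle) w))
  by_cases hcase : ¬ (c - EC) % (q : ℤ) ^ j = 0 ∧ m₁ ≤ k
  · -- (i) `C`-led: `v(y − E_C) = m₁ ≤ k`
    rw [if_pos hcase] at hmis
    simp only [Bool.or_eq_true, Bool.not_eq_true', decide_eq_false_iff_not] at hmis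
    obtain ⟨hδ, hm₁k⟩ := hcase
    have hw' : ¬ (q : ℤ) ∣ w := by
      intro hd
      rcases hunit with h0 | hu
      · exact hδ h0
      · exact hu (Int.emod_eq_zero_of_dvd hd)
    obtain ⟨i, hi⟩ : ∃ i, j = m₁ + (i + 1) := ⟨j - m₁ - 1, by have := hm₁j hδ; omega⟩
    obtain ⟨l, hl⟩ : ∃ l, k = m₁ + l := ⟨k - m₁, by omega⟩
    have hyE' : y - EC = (q : ℤ) ^ m₁ * (w + (q : ℤ) ^ (i + 1) * t) := by
      rw [hyE, hsp, hi, pow_add]; ring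
    have hw'' : ¬ (q : ℤ) ∣ w + (q : ℤ) ^ (i + 1) * t := by
      intro h
      apply hw'
      have h2 : (q : ℤ) ∣ (q : ℤ) ^ (i + 1) * t := dvd_mul_of_dvd_left (dvd_pow_self _ (Nat.succ_ne_zero i)) t
      simpa using dvd_sub h h2
    -- `W' = (w', −q^l B_u)` is `C`-led with leading unit `w' ≡ w`
    have hWp : ¬ ((q : ℤ) ∣ (w + (q : ℤ) ^ (i + 1) * t, -((q : ℤ) ^ l * Bu)).1 ∧
        (q : ℤ) ∣ (w + (q : ℤ) ^ (i + 1) * t, -((q : ℤ) ^ l * Bu)).2) := fun h => hw'' h.1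
    have hr1 : (q : ℤ) ^ N ∣ (q : ℤ) ^ s₂ * (pmul dl U (pmul dl X X)).1 -
        (q : ℤ) ^ (K + m₁) * (w + (q : ℤ) ^ (i + 1) * t, -((q : ℤ) ^ l * Bu)).1 := by
      have e : (q : ℤ) ^ K * (y - EC) = (q : ℤ) ^ (K + m₁) * (w + (q : ℤ) ^ (i + 1) * t) := by
        rw [hyE', pow_add]; ring
      rw [← e]; exact hX1
    have hr2 : (q : ℤ) ^ N ∣ (q : ℤ) ^ s₂ * (pmul dl U (pmul dl X X)).2 -
        (q : ℤ) ^ (K + m₁) * (w + (q : ℤ) ^ (i + 1) * t, -((q : ℤ) ^ l * Bu)).2 := by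
      have e : (q : ℤ) ^ K * (-((q : ℤ) ^ k * Bu)) = (q : ℤ) ^ (K + m₁) * (-((q : ℤ) ^ l * Bu)) := by
        rw [hl, pow_add, pow_add]; ring
      rw [← e]; exact hX2
    have hc := coreRam hq hdl hdlt hU hWp (by omega : K + m₁ < N) hr1 hr2
    rw [(ramE_of_not_dvd (V := (w + (q : ℤ) ^ (i + 1) * t, -((q : ℤ) ^ l * Bu))) hw'').1,
      (ramE_of_not_dvd (V := (w + (q : ℤ) ^ (i + 1) * t, -((q : ℤ) ^ l * Bu))) hw'').2] at hc
    obtain ⟨hE, ω, hω, hdiv⟩ := hc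
    rcases hmis with hE' | hbit
    · rw [hE] at hE'; cases hE'
    · apply hbit
      rw [ramBit_eq, eulerBit_congr (x := w) (y := w + (q : ℤ) ^ (i + 1) * t)
        ⟨-((q : ℤ) ^ i * t), by rw [pow_succ]; ring⟩, ← eulerBit_mul_sq hq hω hdiv]
      have hpar : (s₂ + (K + m₁)) % 2 = (s₂ + m₁) % 2 := by omega
      rw [hpar]
  · -- (ii) `π'`-led: `y − E_C = q^k·D₁` with `q ∣ D₁`, and `k < j`
    rw [if_neg hcase] at hmis
    simp only [Bool.or_eq_true, Bool.not_eq_true', decide_eq_false_iff_not] at hmis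
    have main : k < j ∧ ∃ D₁ : ℤ, y - EC = (q : ℤ) ^ k * D₁ ∧ (q : ℤ) ∣ D₁ := by
      by_cases hδ : (c - EC) % (q : ℤ) ^ j = 0
      · have hkj : k + 1 ≤ j := hdec.resolve_left (fun h => h hδ)
        obtain ⟨d', hd'⟩ := Int.dvd_of_emod_eq_zero hδ
        obtain ⟨i, hi⟩ : ∃ i, j = k + (i + 1) := ⟨j - k - 1, by omega⟩
        refine ⟨by omega, (q : ℤ) ^ (i + 1) * (t + d'), ?_, ?_⟩
        · rw [hyE, hd', hi, pow_add]; ring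
        · rw [pow_succ]; exact ⟨(q : ℤ) ^ i * (t + d'), by ring⟩
      · have hkm : k + 1 ≤ m₁ := by
          by_contra hlt
          push Not at hlt
          exact hcase ⟨hδ, by omega⟩
        have hm₁j' : m₁ < j := hm₁j hδ
        obtain ⟨i, hi⟩ : ∃ i, j = k + (i + 1) := ⟨j - k - 1, by omega⟩
        obtain ⟨l, hl⟩ : ∃ l, m₁ = k + (l + 1) := ⟨m₁ - k - 1, by omega⟩
        refine ⟨by omega, (q : ℤ) ^ (l + 1) * w + (q : ℤ) ^ (i + 1) * t, ?_, ?_⟩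
        · have e : (c - EC) = (q : ℤ) ^ (k + (l + 1)) * w := by rw [← hl]; exact hsp
          rw [hyE, e, hi, pow_add, pow_add]; ring
        · rw [pow_succ, pow_succ]
          exact ⟨(q : ℤ) ^ l * w + (q : ℤ) ^ i * t, by ring⟩
    obtain ⟨hkj, D₁, hD₁, hD₁q⟩ := main
    have hWp : ¬ ((q : ℤ) ∣ (D₁, -Bu).1 ∧ (q : ℤ) ∣ (D₁, -Bu).2) := fun h => hBu (dvd_neg.mp h.2)
    have hr1 : (q : ℤ) ^ N ∣ (q : ℤ) ^ s₂ * (pmul dl U (pmul dl X X)).1 - (q : ℤ) ^ (K + k) * (D₁, -Bu).1 := by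
      have e : (q : ℤ) ^ K * (y - EC) = (q : ℤ) ^ (K + k) * D₁ := by rw [hD₁, pow_add]; ring
      rw [← e]; exact hX1
    have hr2 : (q : ℤ) ^ N ∣ (q : ℤ) ^ s₂ * (pmul dl U (pmul dl X X)).2 - (q : ℤ) ^ (K + k) * (D₁, -Bu).2 := by
      have e : (q : ℤ) ^ K * (-((q : ℤ) ^ k * Bu)) = (q : ℤ) ^ (K + k) * (-Bu) := by rw [pow_add]; ring
      rw [← e]; exact hX2
    have hc := coreRam hq hdl hdlt hU hWp (by omega : K + k < N) hr1 hr2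
    rw [(ramE_of_dvd (V := (D₁, -Bu)) hD₁q).1, (ramE_of_dvd (V := (D₁, -Bu)) hD₁q).2] at hc
    obtain ⟨hE, ω, hω, hdiv⟩ := hc
    rcases hmis with hE' | hbit
    · rw [hE] at hE'; cases hE'
    · apply hbit
      rw [ramBit_eq, eulerBit_congr (x := -Bp) (y := -Bu) (by rw [sub_neg_eq_add, neg_add_eq_sub]; exact hBp), ← eulerBit_mul_sq hq hω hdiv]
      have hpar : (s₂ + (K + k)) % 2 = (s₂ + k) % 2 := by omega
      rw [hpar]

/-- The precision guard of a certified node. [folklore] -/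
theorem walkR_guard {q : ℕ} {ρ : ℤ × ℕ × ℤ} {k : ℕ} {Bp EC : ℤ} {s₂ : ℕ} {e₂ l0 l1 : Bool} {B N : ℕ} :
    ∀ {f : ℕ} {c : ℤ} {j : ℕ}, walkR q ρ k Bp EC s₂ e₂ l0 l1 B N f c j = true → j + B < N
  | 0, c, j, h => by
      simp only [walkR, Bool.and_eq_true, decide_eq_true_eq] at h; exact h.1
  | f + 1, c, j, h => by
      simp only [walkR, Bool.and_eq_true, decide_eq_true_eq] at h; exact h.1

/-- **Walk soundness** (TIER 2r): a certified node `(c, j)` admits no `y ≡ c (mod q^j)` for which both the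
root relation `q^N ∣ q^{s₁}u₁X² − q^K(y − e₁)` and the pair relation
`q^N ∣ q^{s₂}·U·P² − q^K·((y − E_C) − E_B π')` are solvable (`K` even, `K ≤ B`).
[cite: CremonaAlgorithms1997, §3.6] -/
theorem walkR_sound {q : ℕ} (hq : q.Prime) {ρ : ℤ × ℕ × ℤ} (hρ : ¬ (q : ℤ) ∣ ρ.2.2) {dl dlt : ℤ}
    (hdl : dl = (q : ℤ) * dlt) (hdlt : ¬ (q : ℤ) ∣ dlt) {U : ℤ × ℤ} (hU : ¬ ((q : ℤ) ∣ U.1 ∧ (q : ℤ) ∣ U.2))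
    {k : ℕ} {Bp Bu EC : ℤ} (hBu : ¬ (q : ℤ) ∣ Bu) (hBp : (q : ℤ) ∣ Bu - Bp) {s₂ B N K : ℕ}
    (hK : K ≤ B) (hK2 : K % 2 = 0) :
    ∀ (f : ℕ) (c : ℤ) (j : ℕ),
      walkR q ρ k Bp EC s₂ (ramE q U) (eulerBit q (ramU q U)) (eulerBit q (ramU q U * dlt)) B N f c j = true →
      ∀ y : ℤ, (q : ℤ) ^ j ∣ y - c →
      (∃ X : ℤ, (q : ℤ) ^ N ∣ (q : ℤ) ^ ρ.2.1 * ρ.2.2 * X ^ 2 - (q : ℤ) ^ K * (y - ρ.1)) →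
      (∃ X : ℤ × ℤ,
        (q : ℤ) ^ N ∣ (q : ℤ) ^ s₂ * (pmul dl U (pmul dl X X)).1 - (q : ℤ) ^ K * (y - EC) ∧
        (q : ℤ) ^ N ∣ (q : ℤ) ^ s₂ * (pmul dl U (pmul dl X X)).2 - (q : ℤ) ^ K * (-((q : ℤ) ^ k * Bu))) →
      False
  | 0, c, j, h, y, hy, hX1, hX2 => by
      simp only [walkR, Bool.and_eq_true, Bool.or_eq_true, decide_eq_true_eq] at h
      obtain ⟨hj, hm | hm⟩ := h
      · exact outMis_sound hq hρ hm hK hK2 hj hy hX1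
      · exact ramMis_sound hq hdl hdlt hU hBu hBp hm hK hK2 hj hy hX2
  | f + 1, c, j, h, y, hy, hX1, hX2 => by
      simp only [walkR, Bool.and_eq_true, Bool.or_eq_true, decide_eq_true_eq, List.all_eq_true,
        List.mem_range] at h
      obtain ⟨hj, h⟩ := h
      rcases h with (hm | hm) | ⟨-, hall⟩
      · exact outMis_sound hq hρ hm hK hK2 hj hy hX1
      · exact ramMis_sound hq hdl hdlt hU hBu hBp hm hK hK2 hj hy hX2
      · obtain ⟨t, ht⟩ := hy
        obtain ⟨d, hd, hdt⟩ := digit_exists hq.pos t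
        have hw := hall d hd
        rw [Nat.cast_pow] at hw
        refine walkR_sound hq hρ hdl hdlt hU hBu hBp hK hK2 f _ (j + 1) hw y ?_ hX1 hX2
        obtain ⟨kk, hk⟩ := hdt
        exact ⟨kk, by rw [pow_succ]; linear_combination ht + (q : ℤ) ^ j * hk⟩

/-- **From the scaled relations to the walk**: with `w₀ = q^{2τ}·y₀`, `n = q^τ·n'`, `q ∤ n'`, `2τ ≤ B`, the
root relation and the pair relation for `(w₀, n)` contradict a certified walk from `(0, 0)`
(take `y = y₀ / n'²` mod `q^N`). [cite: CremonaAlgorithms1997, §3.6] -/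
theorem kill_scaledR {q : ℕ} (hq : q.Prime) {ρ : ℤ × ℕ × ℤ} (hρ : ¬ (q : ℤ) ∣ ρ.2.2) {dl dlt : ℤ}
    (hdl : dl = (q : ℤ) * dlt) (hdlt : ¬ (q : ℤ) ∣ dlt) {U : ℤ × ℤ} (hU : ¬ ((q : ℤ) ∣ U.1 ∧ (q : ℤ) ∣ U.2))
    {k : ℕ} {Bp Bu EC : ℤ} (hBu : ¬ (q : ℤ) ∣ Bu) (hBp : (q : ℤ) ∣ Bu - Bp) {s₂ B N f τ : ℕ}
    (hτ : 2 * τ ≤ B)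
    (hwalk : walkR q ρ k Bp EC s₂ (ramE q U) (eulerBit q (ramU q U)) (eulerBit q (ramU q U * dlt)) B N f 0 0
      = true)
    {w₀ n y₀ n' : ℤ} (hw₀ : w₀ = (q : ℤ) ^ (2 * τ) * y₀) (hn : n = (q : ℤ) ^ τ * n')
    (hnd : ¬ (q : ℤ) ∣ n')
    (h1 : ∃ R : ℤ, (q : ℤ) ^ N ∣ (q : ℤ) ^ ρ.2.1 * ρ.2.2 * R ^ 2 - (w₀ - n ^ 2 * ρ.1))
    (h2 : ∃ P : ℤ × ℤ,
      (q : ℤ) ^ N ∣ (q : ℤ) ^ s₂ * (pmul dl U (pmul dl P P)).1 - (w₀ - n ^ 2 * EC) ∧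
      (q : ℤ) ^ N ∣ (q : ℤ) ^ s₂ * (pmul dl U (pmul dl P P)).2 - (-(n ^ 2 * ((q : ℤ) ^ k * Bu)))) :
    False := by
  have hpZ : Prime (q : ℤ) := Nat.prime_iff_prime_int.mp hq
  have hcop : IsCoprime n' ((q : ℤ) ^ N) := ((Prime.coprime_iff_not_dvd hpZ).mpr hnd).symm.pow_right
  obtain ⟨m, kk, hmk⟩ := hcop
  have hn2 : n ^ 2 = (q : ℤ) ^ (2 * τ) * n' ^ 2 := by rw [hn, mul_pow, ← pow_mul, mul_comm τ 2]
  refine walkR_sound hq hρ hdl hdlt hU hBu hBp hτ (by omega) f 0 0 hwalk (y₀ * m ^ 2) (by simp) ?_ ?_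
  · obtain ⟨R, t, ht⟩ := h1
    rw [hw₀, hn2] at ht
    exact ⟨R * m, m ^ 2 * t + (q : ℤ) ^ (2 * τ) * ρ.1 * kk * (1 + m * n'), by
      linear_combination m ^ 2 * ht - (q : ℤ) ^ (2 * τ) * ρ.1 * (1 + m * n') * hmk⟩
  · obtain ⟨P, ⟨t1, ht1⟩, ⟨t2, ht2⟩⟩ := h2
    rw [hw₀, hn2] at ht1
    rw [hn2] at ht2
    simp only [pmul] at ht1 ht2
    refine ⟨(m * P.1, m * P.2), ⟨m ^ 2 * t1 + (q : ℤ) ^ (2 * τ) * EC * kk * (1 + m * n'), ?_⟩,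
      ⟨m ^ 2 * t2 + (q : ℤ) ^ (2 * τ) * ((q : ℤ) ^ k * Bu) * kk * (1 + m * n'), ?_⟩⟩
    · simp only [pmul]
      linear_combination m ^ 2 * ht1 - (q : ℤ) ^ (2 * τ) * EC * (1 + m * n') * hmk
    · simp only [pmul]
      linear_combination m ^ 2 * ht2 - (q : ℤ) ^ (2 * τ) * ((q : ℤ) ^ k * Bu) * (1 + m * n') * hmk

end Summit.BirchSwinnertonDyer.BirchSwinnertonDyer.Rank2Observatory.TwoDescKill
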